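import Summits.Parity.GeneralizedHardyLittlewood.Theorems.LeeYangFibresRelativeDimOneMoebiusSplitSingularSeriesAux3
import HarnessLib

/-!
# Crux `RelativeDimOne` (stmt-Parity-14113), line `single-moebius-split`, stub `stub_truncSingularSeries`:
# auxiliary file 4 — the one-variable lemma with frozen primes (OVL / "stage lemma")

`tss_ovl` (registered sub-goal). On top of the twisted lemma `tss_gtl` (`…SingularSeriesAux3`) we allow a finite set
`P` of FROZEN primes, `(∏_{p ∈ P} p)³ ≤ R²`, at which the local weight of the Möbius variable `d` is an arbitrary
pair (`a_p` if `p ∣ d`, `b_p` if `p ∤ d`; no decay, and `b_p = 0` allowed — the resonant primes dividing a later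
variable of the iterated singular series, and the small primes):

  `Σ = ∑_{d ≤ R} μ(d) log(R/d) (∏_{p ∣ d, p ∉ P} w(p)) ∏_{p ∈ P} (a_p 1_{p∣d} + b_p 1_{p∤d})`
  `  = ∏_{p < y} E_p + O(C ∏_{p∈P}(|a_p| + |b_p|) e^{−c√log R})`,  `E_p = (b_p − a_p) p/(p−1)` (`p ∈ P`),
  `E_p = (1 − w(p)) p/(p−1)` (`p ∉ P`),

uniformly in `y > R` (all of `P` below `y`), for twists `w` as in GTL (`|p w(p) − 1| ≤ K/p` off `P ∪ Q`,
`|p w(p)| ≤ K` on `Q`, `|Q| ≤ B log R`). Proof: induction on `P`; splitting `d` according to `q ∣ d` gives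
`Σ(R; P ∪ {q}; w) = b_q Σ(R; P; w[q↦0]) − a_q Σ(R/q; P; w[q↦0])` (`sum_insert_eq`), the zeroed twist moving `q`
into `Q`; the levels stay `≥ R^{1/3}` because `∏ P ≤ R^{2/3}`, and the main terms recombine prime by prime.

References: D. A. Goldston, C. Y. Yıldırım, Integers 3 (2003) A5 = arXiv:math/0111212, Lemma 2.1, §3 [GoldstonYildirim2001].
-/

noncomputable section

open Finset Real ArithmeticFunction Filter
open scoped ArithmeticFunction.Moebius Topology

namespace Summit.Parity.GeneralizedHardyLittlewood.Cruxes.RelativeDimOne.SingleMoebiusSplit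

namespace TSSOvl

open Literature.NumberTheory.Sieve

/-! ### Splitting off one frozen prime -/

/-- The summand of `Σ(R; P; w, a, b)` vanishes at `d` when the twist vanishes at a prime `q ∣ d`, `q ∉ P`.
[folklore] -/
theorem term_eq_zero_of_dvd {w a b : ℕ → ℝ} {P : Finset ℕ} {q d : ℕ} (hq : q.Prime) (hqP : q ∉ P)
    (hw : w q = 0) (hd : d ≠ 0) (hqd : q ∣ d) (R : ℝ) :
    (μ d : ℝ) * Real.log (R / d) * (∏ p ∈ d.primeFactors \ P, w p) *
      (∏ p ∈ P, if p ∣ d then a p else b p) = 0 := by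
  have hmem : q ∈ d.primeFactors \ P := Finset.mem_sdiff.2 ⟨Nat.mem_primeFactors.2 ⟨hq, hqd, hd⟩, hqP⟩
  rw [Finset.prod_eq_zero hmem hw]
  ring

/-- Reindexing the multiples of `q`: `∑_{d ≤ X, q ∣ d} f(d) = ∑_{d' ≤ X/q} f(q d')`. [folklore] -/
theorem sum_filter_dvd_eq {q : ℕ} (hq : 0 < q) (X : ℕ) (f : ℕ → ℝ) :
    ∑ d ∈ (Icc 1 X).filter (fun d => q ∣ d), f d = ∑ d' ∈ Icc 1 (X / q), f (q * d') := by
  refine Finset.sum_nbij' (fun d => d / q) (fun d' => q * d') ?_ ?_ ?_ ?_ ?_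
  · intro d hd
    obtain ⟨hd, hqd⟩ := Finset.mem_filter.1 hd
    obtain ⟨hd1, hdX⟩ := Finset.mem_Icc.1 hd
    refine Finset.mem_Icc.2 ⟨?_, Nat.div_le_div_right hdX⟩
    obtain ⟨e, rfl⟩ := hqd
    rw [Nat.mul_div_cancel_left _ hq]
    rcases Nat.eq_zero_or_pos e with rfl | he
    · simp at hd1
    · exact he
  · intro d' hd'
    obtain ⟨hd1, hdX⟩ := Finset.mem_Icc.1 hd'
    refine Finset.mem_filter.2 ⟨Finset.mem_Icc.2 ⟨Nat.mul_pos hq hd1, ?_⟩, dvd_mul_right q d'⟩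
    rw [mul_comm]
    exact (Nat.le_div_iff_mul_le hq).1 hdX
  · intro d hd
    obtain ⟨-, hqd⟩ := Finset.mem_filter.1 hd
    exact Nat.mul_div_cancel' hqd
  · intro d' _
    exact Nat.mul_div_cancel_left _ hq
  · intro d hd
    obtain ⟨-, hqd⟩ := Finset.mem_filter.1 hd
    rw [Nat.mul_div_cancel' hqd]

/-- **Splitting off a frozen prime.** For a prime `q ∉ P` (`P` a set of primes) and any real `R`:
`Σ(R; P ∪ {q}; w) = b_q Σ(R; P; w[q ↦ 0]) − a_q Σ(R/q; P; w[q ↦ 0])`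
(terms with `q ∤ d` carry `b_q`; terms `d = q d'` carry `a_q` and `μ(q d') = −μ(d')` for `q ∤ d'`; the terms
with `q ∣ d'` vanish on both sides). [folklore] -/
theorem sum_insert_eq (w a b : ℕ → ℝ) {P : Finset ℕ} (hP : ∀ p ∈ P, p.Prime) {q : ℕ} (hq : q.Prime)
    (hqP : q ∉ P) (R : ℝ) :
    ∑ d ∈ Icc 1 ⌊R⌋₊, (μ d : ℝ) * Real.log (R / d) * (∏ p ∈ d.primeFactors \ insert q P, w p) *
        (∏ p ∈ insert q P, if p ∣ d then a p else b p) =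
      b q * ∑ d ∈ Icc 1 ⌊R⌋₊, (μ d : ℝ) * Real.log (R / d) *
          (∏ p ∈ d.primeFactors \ P, Function.update w q 0 p) * (∏ p ∈ P, if p ∣ d then a p else b p) -
        a q * ∑ d ∈ Icc 1 ⌊R / q⌋₊, (μ d : ℝ) * Real.log (R / q / d) *
          (∏ p ∈ d.primeFactors \ P, Function.update w q 0 p) * (∏ p ∈ P, if p ∣ d then a p else b p) := by
  set w₀ := Function.update w q 0 with hw₀
  have hw₀q : w₀ q = 0 := by rw [hw₀, Function.update_self]
  have hw₀p : ∀ p, p ≠ q → w₀ p = w p := fun p hp => by rw [hw₀, Function.update_of_ne hp]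
  have hq0 : q ≠ 0 := hq.ne_zero
  -- the summands
  set T : ℕ → ℝ := fun d => (μ d : ℝ) * Real.log (R / d) * (∏ p ∈ d.primeFactors \ insert q P, w p) *
    (∏ p ∈ insert q P, if p ∣ d then a p else b p) with hT
  set T₀ : ℝ → ℕ → ℝ := fun R' d => (μ d : ℝ) * Real.log (R' / d) *
    (∏ p ∈ d.primeFactors \ P, w₀ p) * (∏ p ∈ P, if p ∣ d then a p else b p) with hT₀
  show ∑ d ∈ Icc 1 ⌊R⌋₊, T d = b q * ∑ d ∈ Icc 1 ⌊R⌋₊, T₀ R d - a q * ∑ d ∈ Icc 1 ⌊R / q⌋₊, T₀ (R / q) d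
  -- `T₀` vanishes at multiples of `q`
  have hT₀zero : ∀ R' d, d ≠ 0 → q ∣ d → T₀ R' d = 0 := fun R' d hd hqd => by
    simp only [hT₀]; exact term_eq_zero_of_dvd hq hqP hw₀q hd hqd R'
  -- Part A: `q ∤ d`
  have hA : ∀ d ∈ Icc 1 ⌊R⌋₊, ¬ q ∣ d → T d = b q * T₀ R d := by
    intro d _ hqd
    simp only [hT, hT₀]
    have h1 : d.primeFactors \ insert q P = d.primeFactors \ P := by
      ext p
      simp only [Finset.mem_sdiff, Finset.mem_insert, not_or]
      constructor
      · rintro ⟨h1, -, h3⟩; exact ⟨h1, h3⟩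
      · rintro ⟨h1, h3⟩
        refine ⟨h1, ?_, h3⟩
        rintro rfl
        exact hqd (Nat.dvd_of_mem_primeFactors h1)
    have h2 : ∏ p ∈ d.primeFactors \ P, w p = ∏ p ∈ d.primeFactors \ P, w₀ p := by
      refine Finset.prod_congr rfl fun p hp => (hw₀p p ?_).symm
      rintro rfl
      exact hqd (Nat.dvd_of_mem_primeFactors (Finset.mem_sdiff.1 hp).1)
    rw [h1, h2, Finset.prod_insert hqP, if_neg hqd]
    ring
  -- Part B: `d = q d'`
  have hB : ∀ d' ∈ Icc 1 ⌊R / q⌋₊, T (q * d') = -(a q * T₀ (R / q) d') := by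
    intro d' hd'
    have hd'0 : d' ≠ 0 := by have := (Finset.mem_Icc.1 hd').1; omega
    by_cases hqd' : q ∣ d'
    · -- both sides vanish
      rw [hT₀zero _ d' hd'0 hqd', mul_zero, neg_zero]
      simp only [hT]
      have : ¬ Squarefree (q * d') := fun hsq => by
        obtain ⟨e, rfl⟩ := hqd'
        exact hq.ne_one (Nat.isUnit_iff.1 (hsq q ⟨e, by ring⟩))
      rw [moebius_eq_zero_of_not_squarefree this]
      simp
    · simp only [hT, hT₀]
      have hcop : Nat.Coprime q d' := (Nat.Prime.coprime_iff_not_dvd hq).2 hqd'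
      have hmu : (μ (q * d') : ℝ) = -(μ d' : ℝ) := by
        rw [isMultiplicative_moebius.map_mul_of_coprime hcop, moebius_apply_prime hq]
        push_cast
        ring
      have hlog : Real.log (R / ((q * d' : ℕ) : ℝ)) = Real.log (R / q / d') := by
        rw [Nat.cast_mul, div_div]
      have hpf : (q * d').primeFactors \ insert q P = d'.primeFactors \ P := by
        rw [Nat.primeFactors_mul hq0 hd'0, hq.primeFactors]
        ext p
        simp only [Finset.mem_sdiff, Finset.mem_union, Finset.mem_singleton, Finset.mem_insert, not_or]
        constructor
        · rintro ⟨h1 | h1, h2, h3⟩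
          · exact absurd h1 h2
          · exact ⟨h1, h3⟩
        · rintro ⟨h1, h3⟩
          have : p ≠ q := by rintro rfl; exact hqd' (Nat.dvd_of_mem_primeFactors h1)
          exact ⟨Or.inr h1, this, h3⟩
      have hprodw : ∏ p ∈ d'.primeFactors \ P, w p = ∏ p ∈ d'.primeFactors \ P, w₀ p := by
        refine Finset.prod_congr rfl fun p hp => (hw₀p p ?_).symm
        rintro rfl
        exact hqd' (Nat.dvd_of_mem_primeFactors (Finset.mem_sdiff.1 hp).1)
      have hprodP : (∏ p ∈ P, if p ∣ q * d' then a p else b p) = ∏ p ∈ P, if p ∣ d' then a p else b p := by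
        refine Finset.prod_congr rfl fun p hp => ?_
        have hpq : p ≠ q := by rintro rfl; exact hqP hp
        have hiff : p ∣ q * d' ↔ p ∣ d' := by
          refine ⟨fun h => ?_, fun h => h.mul_left q⟩
          rcases (Nat.Prime.dvd_mul (hP p hp)).1 h with h1 | h1
          · exact absurd ((Nat.prime_dvd_prime_iff_eq (hP p hp) hq).1 h1) hpq
          · exact h1
        simp only [hiff]
      rw [hmu, hlog, hpf, hprodw, Finset.prod_insert hqP, if_pos (dvd_mul_right q d'), hprodP]
      ring
  -- assemble
  rw [← Finset.sum_filter_add_sum_filter_not (Icc 1 ⌊R⌋₊) (fun d => q ∣ d),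
    sum_filter_dvd_eq hq.pos _ T, ← Nat.floor_div_natCast, Finset.sum_congr rfl hB,
    Finset.sum_congr rfl fun d hd => hA d (Finset.mem_filter.1 hd).1 (Finset.mem_filter.1 hd).2,
    ← Finset.mul_sum, Finset.sum_neg_distrib, ← Finset.mul_sum]
  -- the `q ∤ d` restriction on the `T₀ R` sum is free
  have hfree : ∑ d ∈ (Icc 1 ⌊R⌋₊).filter (fun d => ¬ q ∣ d), T₀ R d = ∑ d ∈ Icc 1 ⌊R⌋₊, T₀ R d := by
    rw [Finset.sum_filter]
    refine Finset.sum_congr rfl fun d hd => ?_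
    by_cases h : q ∣ d
    · simp only [h, not_true_eq_false, if_false]
      exact (hT₀zero R d (by have := (Finset.mem_Icc.1 hd).1; omega) h).symm
    · simp only [h, not_false_eq_true, if_true]
  rw [hfree]
  ring

/-! ### The main terms recombine prime by prime -/

/-- `∏_{p<y} E_p(P ∪ {q}; w) = (b_q − a_q) ∏_{p<y} E_p(P; w[q ↦ 0])` for a prime `q < y`, `q ∉ P`.
[folklore] -/
theorem prod_insert_eq (w a b : ℕ → ℝ) {P : Finset ℕ} {q y : ℕ} (hq : q.Prime) (hqP : q ∉ P) (hqy : q < y) :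
    ∏ p ∈ Nat.primesBelow y, (if p ∈ insert q P then (b p - a p) else (1 - w p)) * ((p : ℝ) / ((p : ℝ) - 1)) =
      (b q - a q) * ∏ p ∈ Nat.primesBelow y,
        (if p ∈ P then (b p - a p) else (1 - Function.update w q 0 p)) * ((p : ℝ) / ((p : ℝ) - 1)) := by
  have hqmem : q ∈ Nat.primesBelow y := Nat.mem_primesBelow.2 ⟨hqy, hq⟩
  rw [← Finset.mul_prod_erase _ _ hqmem, ← Finset.mul_prod_erase _ _ hqmem, if_pos (Finset.mem_insert_self q P),
    Function.update_self]
  have hrest : ∏ p ∈ (Nat.primesBelow y).erase q,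
      (if p ∈ insert q P then (b p - a p) else (1 - w p)) * ((p : ℝ) / ((p : ℝ) - 1)) =
      ∏ p ∈ (Nat.primesBelow y).erase q,
        (if p ∈ P then (b p - a p) else (1 - Function.update w q 0 p)) * ((p : ℝ) / ((p : ℝ) - 1)) := by
    refine Finset.prod_congr rfl fun p hp => ?_
    have hpq : p ≠ q := Finset.ne_of_mem_erase hp
    rw [Function.update_of_ne hpq]
    by_cases hpP : p ∈ P
    · rw [if_pos hpP, if_pos (Finset.mem_insert_of_mem hpP)]
    · rw [if_neg hpP, if_neg (by rw [Finset.mem_insert]; push Not; exact ⟨hpq, hpP⟩)]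
  rw [hrest, if_neg hqP, sub_zero]
  ring

/-! ### Induction on the frozen set -/

/-- The induction over the frozen set `P` at floor level `ρ ≥ 2` (levels `R ∈ [ρ ∏P, ρ³]`), given the twisted
lemma as a hypothesis `hgtl` with constants `(c, C)` for `(K, B₁)`. [folklore] -/
theorem ovl_induct {c C : ℝ} {K : ℕ} {B₁ : ℝ} (hc : 0 ≤ c) (hC : 0 ≤ C) (hB₁ : 0 ≤ B₁)
    (hgtl : ∀ (w : ℕ → ℝ) (Q : Finset ℕ), (∀ p ∈ Q, p.Prime) →
      (∀ p : ℕ, p.Prime → p ∉ Q → |(p : ℝ) * w p - 1| ≤ K / p) →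
      (∀ p ∈ Q, |(p : ℝ) * w p| ≤ K) →
      ∀ u : ℝ, 2 ≤ u → (Q.card : ℝ) ≤ B₁ * Real.log u →
      ∀ y : ℕ, ⌊u⌋₊ < y →
        |(∑ e ∈ Finset.Icc 1 ⌊u⌋₊, ((ArithmeticFunction.moebius e : ℤ) : ℝ) * Real.log (u / e) *
            ∏ p ∈ e.primeFactors, w p) -
          ∏ p ∈ Nat.primesBelow y, (1 - w p) * ((p : ℝ) / ((p : ℝ) - 1))| ≤
        C * Real.exp (-(c * Real.sqrt (Real.log u))))
    {ρ : ℝ} (hρ : 2 ≤ ρ) (y : ℕ) :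
    ∀ P : Finset ℕ, (∀ p ∈ P, p.Prime) → (∀ p ∈ P, p < y) →
      ∀ (w a b : ℕ → ℝ) (Q : Finset ℕ), (∀ p ∈ Q, p.Prime) →
        (∀ p : ℕ, p.Prime → p ∉ P → p ∉ Q → |(p : ℝ) * w p - 1| ≤ K / p) →
        (∀ p ∈ Q, |(p : ℝ) * w p| ≤ K) →
        ((Q.card : ℝ) + P.card ≤ B₁ * Real.log ρ) →
        ∀ R : ℝ, ρ * ∏ p ∈ P, (p : ℝ) ≤ R → R ≤ ρ ^ 3 → ⌊R⌋₊ < y →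
          |(∑ d ∈ Icc 1 ⌊R⌋₊, (μ d : ℝ) * Real.log (R / d) * (∏ p ∈ d.primeFactors \ P, w p) *
              (∏ p ∈ P, if p ∣ d then a p else b p)) -
            ∏ p ∈ Nat.primesBelow y, (if p ∈ P then (b p - a p) else (1 - w p)) * ((p : ℝ) / ((p : ℝ) - 1))| ≤
          C * (∏ p ∈ P, (|a p| + |b p|)) * Real.exp (-(c * Real.sqrt (Real.log ρ))) := by
  intro P
  induction P using Finset.induction_on with
  | empty =>
    intro _ _ w a b Q hQp hgen hQ hcard R hR1 hR2 hRy
    simp only [Finset.sdiff_empty, Finset.prod_empty, mul_one, Finset.notMem_empty, if_false]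
    rw [Finset.prod_empty, mul_one] at hR1
    have hR2' : 2 ≤ R := hρ.trans hR1
    have hlog : Real.log ρ ≤ Real.log R := Real.log_le_log (by linarith) hR1
    have hcard' : (Q.card : ℝ) ≤ B₁ * Real.log R := by
      rw [Finset.card_empty, Nat.cast_zero, add_zero] at hcard
      exact hcard.trans (mul_le_mul_of_nonneg_left hlog hB₁)
    refine (hgtl w Q hQp (fun p hp hpQ => hgen p hp (Finset.notMem_empty p) hpQ) hQ R hR2' hcard' y hRy).trans ?_
    exact mul_le_mul_of_nonneg_left (Real.exp_le_exp.2 (neg_le_neg (mul_le_mul_of_nonneg_left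
      (Real.sqrt_le_sqrt hlog) hc))) hC
  | insert q P hqP ih =>
    intro hPp hPy w a b Q hQp hgen hQ hcard R hR1 hR2 hRy
    have hq : q.Prime := hPp q (Finset.mem_insert_self q P)
    have hqy : q < y := hPy q (Finset.mem_insert_self q P)
    have hPp' : ∀ p ∈ P, p.Prime := fun p hp => hPp p (Finset.mem_insert_of_mem hp)
    have hPy' : ∀ p ∈ P, p < y := fun p hp => hPy p (Finset.mem_insert_of_mem hp)
    have hq0 : (0 : ℝ) < q := by exact_mod_cast hq.pos
    have hq1 : (1 : ℝ) ≤ q := by exact_mod_cast hq.one_lt.le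
    have hρ0 : 0 < ρ := by linarith
    have hprodP0 : 0 < ∏ p ∈ P, (p : ℝ) := Finset.prod_pos fun p hp => by exact_mod_cast (hPp' p hp).pos
    -- the zeroed twist and the enlarged rough set
    set w₀ := Function.update w q 0 with hw₀
    set Q₀ := insert q Q with hQ₀
    have hQ₀p : ∀ p ∈ Q₀, p.Prime := fun p hp => by
      rcases Finset.mem_insert.1 hp with rfl | hp
      · exact hq
      · exact hQp p hp
    have hgen₀ : ∀ p : ℕ, p.Prime → p ∉ P → p ∉ Q₀ → |(p : ℝ) * w₀ p - 1| ≤ K / p := by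
      intro p hp hpP hpQ₀
      rw [hQ₀, Finset.mem_insert, not_or] at hpQ₀
      rw [hw₀, Function.update_of_ne hpQ₀.1]
      exact hgen p hp (by rw [Finset.mem_insert, not_or]; exact ⟨hpQ₀.1, hpP⟩) hpQ₀.2
    have hQ₀b : ∀ p ∈ Q₀, |(p : ℝ) * w₀ p| ≤ K := by
      intro p hp
      by_cases hpq : p = q
      · rw [hpq, hw₀, Function.update_self, mul_zero, abs_zero]; exact Nat.cast_nonneg K
      · rw [hw₀, Function.update_of_ne hpq]
        rcases Finset.mem_insert.1 hp with h | h
        · exact absurd h hpq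
        · exact hQ p h
    have hcard₀ : (Q₀.card : ℝ) + P.card ≤ B₁ * Real.log ρ := by
      refine le_trans ?_ hcard
      rw [Finset.card_insert_of_notMem hqP]
      have : Q₀.card ≤ Q.card + 1 := Finset.card_insert_le q Q
      push_cast
      have : (Q₀.card : ℝ) ≤ Q.card + 1 := by exact_mod_cast this
      linarith
    -- levels
    rw [Finset.prod_insert hqP] at hR1
    have hR1a : ρ * ∏ p ∈ P, (p : ℝ) ≤ R := by
      refine le_trans ?_ hR1
      refine mul_le_mul_of_nonneg_left ?_ hρ0.le
      exact le_mul_of_one_le_left hprodP0.le hq1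
    have hR1b : ρ * ∏ p ∈ P, (p : ℝ) ≤ R / q := by
      rw [le_div_iff₀ hq0]; linarith [hR1]
    have hR0 : 0 ≤ R := le_trans (by positivity) hR1a
    have hRq : R / q ≤ R := (div_le_iff₀ hq0).2 (le_mul_of_one_le_right hR0 hq1)
    have hR2b : R / q ≤ ρ ^ 3 := hRq.trans hR2
    have hRyb : ⌊R / q⌋₊ < y := lt_of_le_of_lt (Nat.floor_mono hRq) hRy
    -- the two instances of the induction hypothesis
    have ih1 := ih hPp' hPy' w₀ a b Q₀ hQ₀p hgen₀ hQ₀b hcard₀ R hR1a hR2 hRy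
    have ih2 := ih hPp' hPy' w₀ a b Q₀ hQ₀p hgen₀ hQ₀b hcard₀ (R / q) hR1b hR2b hRyb
    -- the splitting identities
    rw [sum_insert_eq w a b hPp' hq hqP R, prod_insert_eq w a b hq hqP hqy, Finset.prod_insert hqP]
    set X := C * (∏ p ∈ P, (|a p| + |b p|)) * Real.exp (-(c * Real.sqrt (Real.log ρ))) with hX
    set S₁ := ∑ d ∈ Icc 1 ⌊R⌋₊, (μ d : ℝ) * Real.log (R / d) * (∏ p ∈ d.primeFactors \ P, w₀ p) *
      (∏ p ∈ P, if p ∣ d then a p else b p) with hS₁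
    set S₂ := ∑ d ∈ Icc 1 ⌊R / q⌋₊, (μ d : ℝ) * Real.log (R / q / d) * (∏ p ∈ d.primeFactors \ P, w₀ p) *
      (∏ p ∈ P, if p ∣ d then a p else b p) with hS₂
    set E := ∏ p ∈ Nat.primesBelow y, (if p ∈ P then (b p - a p) else (1 - w₀ p)) * ((p : ℝ) / ((p : ℝ) - 1))
      with hE
    have hX0 : 0 ≤ X := by positivity
    calc |b q * S₁ - a q * S₂ - (b q - a q) * E| = |b q * (S₁ - E) - a q * (S₂ - E)| := by ring_nf
      _ ≤ |b q * (S₁ - E)| + |a q * (S₂ - E)| := abs_sub _ _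
      _ = |b q| * |S₁ - E| + |a q| * |S₂ - E| := by rw [abs_mul, abs_mul]
      _ ≤ |b q| * X + |a q| * X :=
          add_le_add (mul_le_mul_of_nonneg_left ih1 (abs_nonneg _)) (mul_le_mul_of_nonneg_left ih2 (abs_nonneg _))
      _ = C * ((|a q| + |b q|) * ∏ p ∈ P, (|a p| + |b p|)) * Real.exp (-(c * Real.sqrt (Real.log ρ))) := by
          rw [hX]; ring

/-- `|P| ≤ log R` for a set of primes with `(∏ P)³ ≤ R²`, `R ≥ 1` (`2^{|P|} ≤ ∏ P`, `3 log 2 > 2`). [folklore] -/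
theorem card_le_log {P : Finset ℕ} (hP : ∀ p ∈ P, p.Prime) {R : ℝ} (hR : 1 ≤ R)
    (hPR : (∏ p ∈ P, (p : ℝ)) ^ 3 ≤ R ^ 2) : (P.card : ℝ) ≤ Real.log R := by
  have h2 : (2 : ℝ) ^ P.card ≤ ∏ p ∈ P, (p : ℝ) := by
    rw [← Finset.prod_const]
    exact Finset.prod_le_prod (fun _ _ => by norm_num) fun p hp => by exact_mod_cast (hP p hp).two_le
  have h3 : ((2 : ℝ) ^ P.card) ^ 3 ≤ R ^ 2 := le_trans (pow_le_pow_left₀ (by positivity) h2 3) hPR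
  have h4 : (3 * P.card : ℝ) * Real.log 2 ≤ 2 * Real.log R := by
    have := Real.log_le_log (by positivity) h3
    rw [Real.log_pow, Real.log_pow, Real.log_pow] at this
    push_cast at this
    linarith
  have hlogR : 0 ≤ Real.log R := Real.log_nonneg hR
  nlinarith [Real.log_two_gt_d9, Nat.cast_nonneg (α := ℝ) P.card]

end TSSOvl

/-! ### The registered sub-goal of this file: the one-variable lemma with frozen primes -/

open Literature.NumberTheory.Sieve TSSOvl in
/-- **OVL — the one-variable Goldston–Yıldırım lemma with frozen primes** (sub-goal `tss_ovl` of
`stub_truncSingularSeries`). There is an absolute `c > 0` such that for all `K : ℕ`, `B ≥ 0` there is `C` with: for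
every twist `w`, frozen data `a, b`, finite sets of primes `P` (frozen) and `Q` (rough) with `|p w(p) − 1| ≤ K/p`
(`p ∉ P ∪ Q`) and `|p w(p)| ≤ K` (`p ∈ Q`), every `R ≥ 8` with `(∏ P)³ ≤ R²` and `|Q| ≤ B log R`, and every `y > R`
exceeding all of `P`,
`|∑_{d ≤ R} μ(d) log(R/d) (∏_{p∣d, p∉P} w(p)) ∏_{p∈P}(a_p 1_{p∣d} + b_p 1_{p∤d}) − ∏_{p<y} E_p| ≤ C ∏_{p∈P}(|a_p|+|b_p|) e^{−c√log R}`,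
`E_p = (b_p − a_p) p/(p−1)` on `P` and `(1 − w(p)) p/(p−1)` off `P`. [cite: GoldstonYildirim2001, Lemma 2.1] -/
theorem tss_ovl : ∃ c : ℝ, 0 < c ∧ ∀ (K : ℕ) (B : ℝ), 0 ≤ B → ∃ C : ℝ, 0 ≤ C ∧
    ∀ (w a b : ℕ → ℝ) (P Q : Finset ℕ), (∀ p ∈ P, p.Prime) → (∀ p ∈ Q, p.Prime) →
      (∀ p : ℕ, p.Prime → p ∉ P → p ∉ Q → |(p : ℝ) * w p - 1| ≤ K / p) →
      (∀ p ∈ Q, |(p : ℝ) * w p| ≤ K) →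
      ∀ R : ℝ, 8 ≤ R → (∏ p ∈ P, (p : ℝ)) ^ 3 ≤ R ^ 2 → (Q.card : ℝ) ≤ B * Real.log R →
      ∀ y : ℕ, ⌊R⌋₊ < y → (∀ p ∈ P, p < y) →
        |(∑ d ∈ Finset.Icc 1 ⌊R⌋₊, ((ArithmeticFunction.moebius d : ℤ) : ℝ) * Real.log (R / d) *
            (∏ p ∈ d.primeFactors \ P, w p) * (∏ p ∈ P, if p ∣ d then a p else b p)) -
          ∏ p ∈ Nat.primesBelow y, (if p ∈ P then (b p - a p) else (1 - w p)) * ((p : ℝ) / ((p : ℝ) - 1))| ≤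
        C * (∏ p ∈ P, (|a p| + |b p|)) * Real.exp (-(c * Real.sqrt (Real.log R))) := by
  obtain ⟨c, hc, hC⟩ := tss_gtl
  refine ⟨c / 2, by positivity, fun K B hB => ?_⟩
  obtain ⟨C, hC0, hgtl⟩ := hC K (3 * (B + 1)) (by positivity)
  refine ⟨C, hC0, ?_⟩
  intro w a b P Q hPp hQp hgen hQ R hR8 hPR hcard y hRy hPy
  have hR1 : (1 : ℝ) ≤ R := by linarith
  have hR0 : (0 : ℝ) < R := by linarith
  -- the floor level `ρ = R^{1/3}`
  set ρ : ℝ := R ^ (1 / 3 : ℝ) with hρ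
  have hρ0 : 0 < ρ := Real.rpow_pos_of_pos hR0 _
  have hρ3 : ρ ^ 3 = R := by
    rw [hρ, ← Real.rpow_natCast, ← Real.rpow_mul hR0.le]; norm_num
  have hρ2 : 2 ≤ ρ := by
    have h8 : (2 : ℝ) ^ 3 ≤ ρ ^ 3 := by rw [hρ3]; norm_num; exact hR8
    exact le_of_pow_le_pow_left₀ (by norm_num) hρ0.le h8
  have hlogρ : Real.log ρ = Real.log R / 3 := by
    rw [hρ, Real.log_rpow hR0]; ring
  -- `ρ ∏P ≤ R`
  have hprod0 : 0 ≤ ∏ p ∈ P, (p : ℝ) := Finset.prod_nonneg fun p _ => Nat.cast_nonneg p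
  have hlev : ρ * ∏ p ∈ P, (p : ℝ) ≤ R := by
    have h1 : (ρ * ∏ p ∈ P, (p : ℝ)) ^ 3 ≤ R ^ 3 := by
      calc (ρ * ∏ p ∈ P, (p : ℝ)) ^ 3 = R * (∏ p ∈ P, (p : ℝ)) ^ 3 := by rw [mul_pow, hρ3]
        _ ≤ R * R ^ 2 := mul_le_mul_of_nonneg_left hPR hR0.le
        _ = R ^ 3 := by ring
    exact le_of_pow_le_pow_left₀ (by norm_num) hR0.le h1
  -- the card bound at level `ρ`
  have hcardρ : (Q.card : ℝ) + P.card ≤ 3 * (B + 1) * Real.log ρ := by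
    rw [hlogρ]
    have := card_le_log hPp hR1 hPR
    nlinarith [Real.log_nonneg hR1]
  have hmain := ovl_induct hc.le hC0 (by positivity) hgtl hρ2 y P hPp hPy w a b Q hQp hgen hQ hcardρ R hlev
    (by rw [hρ3]) hRy
  refine hmain.trans (mul_le_mul_of_nonneg_left (Real.exp_le_exp.2 ?_) (by positivity))
  -- `c √(log R /3) ≥ (c/2) √(log R)`
  rw [hlogρ, neg_le_neg_iff]
  have hl0 : 0 ≤ Real.log R := Real.log_nonneg hR1
  have h1 : Real.sqrt (Real.log R) / 2 ≤ Real.sqrt (Real.log R / 3) := by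
    rw [div_le_iff₀ (by norm_num : (0 : ℝ) < 2), Real.sqrt_div' _ (by norm_num : (0 : ℝ) ≤ 3)]
    rw [div_mul_eq_mul_div, le_div_iff₀ (Real.sqrt_pos.2 (by norm_num : (0 : ℝ) < 3))]
    have hs3 : Real.sqrt 3 ≤ 2 := by
      rw [show (2 : ℝ) = Real.sqrt (2 ^ 2) by rw [Real.sqrt_sq (by norm_num)]]
      exact Real.sqrt_le_sqrt (by norm_num)
    nlinarith [Real.sqrt_nonneg (Real.log R)]
  nlinarith

end Summit.Parity.GeneralizedHardyLittlewood.Cruxes.RelativeDimOne.SingleMoebiusSplit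

end
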